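import Summits.ResolutionOfSingularities.ResolutionOfSingularities.Theorems.PurelyInseparableDim4HasseEuler
import Literature.AlgebraicGeometry.Resolution.PointBlowupMohWitnessPrimePower
import Literature.AlgebraicGeometry.Resolution.PointBlowupMohBound
import HarnessLib

/-!
# The Hasse–Euler digit LADDER (Step (β) of the plateau law Π, cell `res-dim4-pi`, I-5-5)

[OURS · counted 0 · instrument lemma]  Nothing here is a statement about resolution of singularities in
dimension ≥ 4 / characteristic `p`, which is NOT proved.  Pure algebra over the Hasse–Euler brick
(`Theorems/PurelyInseparableDim4HasseEuler.lean`): the kernel version of the «digit ladder» of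
res-dim4-crit-2 (V-B-22 second addendum, FIRST) / res-dim4-crit-3 (V-A3-03 add. 2) / res-dim4-idea-5
(PROOF-3; consolidated write-up `PiPlateau-consolidated.md` §4 Step (β)).

Data: a field `K` of characteristic `p`, `q = p^e`, a translation `t`, a finite family of DISTINCT
exponents `β ∈ B` with non-zero coefficients `c β`, an offset `R` (= `|r|`, the lost exceptional
multiplicities) and a level `s` with `q ∣ s` and `|β| + R ≤ s` on `B`; write
`W_f := Σ_{β ∈ B} C(|β| + R, p^f) · c_β x^β`.

* `rung` — ONE RUNG `I_f ⇒ I_{f+1}` (`f < e`): if `p^f ∣ |β| + R` on `B` and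
  `ord₀ (W_f(x + t)) ≥ s − R + 1 − p^f`, then `p^{f+1} ∣ |β| + R` on `B` (digit `f` of `s` vanishes as
  `f < e`; the other terms have degree `≤ s − R − p^f`; a translated polynomial of degree `≤ D` and order
  `≥ D + 1` is zero; Lucas `C(m, p^f) ≡ ⌊m / p^f⌋ (mod p)` = tree `choose_prime_pow_modEq_div`);
* `ladder` — the induction `I_0 ⇒ … ⇒ I_e`: `p^e ∣ |β| + R` on `B`;
* `ordZero_translate_monomial_mul` — the unit factor `E = (x + t)^r`, `t ≠ 0` on `supp r`, does not
  change `ord₀`;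
* **`step_beta_core`** — HYPOTHESIS H of the write-up (every monomial of `G_A(x) = ((x+t)^r · Σ_β c_β x^β)(x + t)`
  … precisely of `P := translate t (x^r · Σ_{β∈B} c_β x^β)` of degree `≤ s − R` is a `q`-th power)
  IMPLIES `q ∣ |β| + R` for every `β ∈ B` — so a witness exponent with `|a_T| ≢ 0 (mod q)` contradicts H.
  (`ord₀` bounds from `HasseEuler.le_ordZero_translate_diagonal`.)

NOT here: the class bookkeeping T1–T4, Step (α), and the assembly `PiPlateau` (idea-5 §6).
Typed by res-dim4-typ-1.  Supports stmt-ResolutionOfSingularities-16155 (helper).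
bears_on: LADDER-RESOLUTION:D157-DOOR2 (res-dim4-pi · I-5-5 Π · Hasse–Euler ladder).
-/

set_option linter.dupNamespace false -- mandated namespace of this single-conjunct summit

namespace Summit.ResolutionOfSingularities.ResolutionOfSingularities.Theorems.PIDim4

namespace HasseEuler

open MvPolynomial Finset
open Literature.AlgebraicGeometry.Resolution
open Literature.AlgebraicGeometry.Resolution.Hauser2010

variable {σ : Type*} [Fintype σ] [DecidableEq σ] {K : Type*} [Field K]

/-! ## §1 Degree-versus-order kill for translated polynomials -/

/-- Every monomial of `W(x + t)` lies below a monomial of `W`; in particular its total degree is at most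
the largest degree occurring in `W`. [folklore] -/
theorem degree_le_of_mem_support_translate (t : σ → K) (W : MvPolynomial σ K) {D : ℕ}
    (hW : ∀ β ∈ W.support, β.degree ≤ D) {γ : σ →₀ ℕ}
    (hγ : γ ∈ (PointBlowup.translate t W).support) : γ.degree ≤ D := by
  obtain ⟨β, hβ, hle⟩ := PointBlowup.exists_le_of_mem_support_translate t W hγ
  exact le_trans (Finsupp.degree_mono hle) (hW β hβ)

/-- **(Z)**: a polynomial all of whose monomials have degree `≤ D` and whose translate has `ord₀ ≥ D + 1`
is zero (translation is injective and does not raise degrees). [folklore] -/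
theorem eq_zero_of_degree_le_of_ordZero_translate (t : σ → K) (W : MvPolynomial σ K) {D : ℕ}
    (hW : ∀ β ∈ W.support, β.degree ≤ D)
    (hord : ((D + 1 : ℕ) : ℕ∞) ≤ ordZero (PointBlowup.translate t W)) : W = 0 := by
  by_contra hne
  have hT : PointBlowup.translate t W ≠ 0 := PointBlowup.translate_ne_zero t hne
  obtain ⟨γ, hγ⟩ := MvPolynomial.support_nonempty.mpr hT
  have h1 : γ.degree ≤ D := degree_le_of_mem_support_translate t W hW hγ
  have h2 := (natCast_le_ordZero_iff_forall_coeff _ _).mp hord γ (by omega)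
  exact (MvPolynomial.mem_support_iff.mp hγ) h2

/-! ## §2 One rung of the ladder and the ladder -/

omit [Fintype σ] in
/-- The level-`f` combination `W_f = Σ_{β ∈ B} C(|β| + R, p^f) · c_β x^β`. [folklore] -/
noncomputable def rungPoly (p f R : ℕ) (B : Finset (σ →₀ ℕ)) (c : (σ →₀ ℕ) → K) :
    MvPolynomial σ K :=
  ∑ β ∈ B, (((β.degree + R).choose (p ^ f) : ℕ) : K) • monomial β (c β)

omit [Fintype σ] in
/-- Coefficients of `W_f`. [folklore] -/
theorem coeff_rungPoly (p f R : ℕ) (B : Finset (σ →₀ ℕ)) (c : (σ →₀ ℕ) → K) (γ : σ →₀ ℕ) :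
    coeff γ (rungPoly p f R B c) =
      if γ ∈ B then (((γ.degree + R).choose (p ^ f) : ℕ) : K) * c γ else 0 := by
  unfold rungPoly
  rw [coeff_sum]
  simp_rw [coeff_smul, coeff_monomial, smul_eq_mul]
  split_ifs with hγ
  · rw [Finset.sum_eq_single γ]
    · rw [if_pos rfl]
    · intro β _ hβ; rw [if_neg hβ, mul_zero]
    · intro h; exact absurd hγ h
  · refine Finset.sum_eq_zero fun β hβ => ?_
    rw [if_neg, mul_zero]
    rintro rfl
    exact hγ hβ

/-- In characteristic `p`: `C(m, p^f) = 0` in `K` iff the `f`-th `p`-adic digit of `m` vanishes, and with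
`p^f ∣ m` this means `p^{f+1} ∣ m`. [folklore] -/
theorem pow_succ_dvd_of_natCast_choose_eq_zero (p : ℕ) [hp : Fact p.Prime] [CharP K p] {m f : ℕ}
    (hm : p ^ f ∣ m) (h : ((m.choose (p ^ f) : ℕ) : K) = 0) : p ^ (f + 1) ∣ m := by
  rw [natCast_choose_prime_pow_eq_zero_iff p K] at h
  obtain ⟨a, rfl⟩ := hm
  rw [Nat.mul_div_cancel_left _ (pow_pos hp.out.pos f)] at h
  obtain ⟨b, rfl⟩ := h
  exact ⟨b, by ring⟩

/-- The `f`-th digit of a multiple of `p^{f+1}` vanishes: `C(s, p^f) = 0` in `K`. [folklore] -/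
theorem natCast_choose_pow_eq_zero_of_pow_succ_dvd (p : ℕ) [hp : Fact p.Prime] [CharP K p] {s f : ℕ}
    (hs : p ^ (f + 1) ∣ s) : ((s.choose (p ^ f) : ℕ) : K) = 0 := by
  rw [natCast_choose_prime_pow_eq_zero_iff p K]
  obtain ⟨a, rfl⟩ := hs
  rw [pow_succ, mul_assoc, Nat.mul_div_cancel_left _ (pow_pos hp.out.pos f)]
  exact dvd_mul_right p a

/-- **ONE RUNG `I_f ⇒ I_{f+1}`** of the digit ladder. [folklore] -/
theorem rung (p : ℕ) [hp : Fact p.Prime] [CharP K p] {e f : ℕ} (hf : f < e) (t : σ → K)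
    (B : Finset (σ →₀ ℕ)) (c : (σ →₀ ℕ) → K) (hc : ∀ β ∈ B, c β ≠ 0) (R s : ℕ) (hs : p ^ e ∣ s)
    (hdeg : ∀ β ∈ B, β.degree + R ≤ s) (hI : ∀ β ∈ B, p ^ f ∣ β.degree + R)
    (hord : ((s - R + 1 - p ^ f : ℕ) : ℕ∞) ≤ ordZero (PointBlowup.translate t (rungPoly p f R B c))) :
    ∀ β ∈ B, p ^ (f + 1) ∣ β.degree + R := by
  have hs1 : p ^ (f + 1) ∣ s := (pow_dvd_pow p (by omega)).trans hs
  have hpf0 : 0 < p ^ f := pow_pos hp.out.pos f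
  -- two multiples of `p^f` that differ, differ by at least `p^f`
  have hstep : ∀ β ∈ B, β.degree + R < s → β.degree + R + p ^ f ≤ s := by
    intro β hβ hlt
    obtain ⟨a, ha⟩ := hI β hβ
    obtain ⟨b, hb⟩ := (pow_dvd_pow p hf.le).trans hs
    have hab : a < b := Nat.lt_of_mul_lt_mul_left (a := p ^ f) (by rw [← ha, ← hb]; exact hlt)
    calc β.degree + R + p ^ f = p ^ f * (a + 1) := by rw [ha]; ring
      _ ≤ p ^ f * b := Nat.mul_le_mul_left _ hab
      _ = s := hb.symm
  -- the level-`s` coefficients of `W_f` vanish; the others sit in degree `≤ s - R - p^f`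
  have hWdeg : ∀ γ ∈ (rungPoly p f R B c).support, γ.degree ≤ s - R - p ^ f := by
    intro γ hγ
    rw [MvPolynomial.mem_support_iff, coeff_rungPoly] at hγ
    split_ifs at hγ with hγB
    · rcases (hdeg γ hγB).lt_or_eq with hlt | heq
      · have := hstep γ hγB hlt; omega
      · exfalso; apply hγ
        rw [heq, natCast_choose_pow_eq_zero_of_pow_succ_dvd p hs1, zero_mul]
    · exact absurd rfl hγ
  intro β hβ
  rcases (hdeg β hβ).lt_or_eq with hlt | heq
  · -- then `p^f ≤ s - R` and the order hypothesis reads `ord₀ ≥ (s - R - p^f) + 1`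
    have hβs := hstep β hβ hlt
    have hord' : (((s - R - p ^ f) + 1 : ℕ) : ℕ∞) ≤
        ordZero (PointBlowup.translate t (rungPoly p f R B c)) := by
      have : s - R - p ^ f + 1 = s - R + 1 - p ^ f := by omega
      rw [this]; exact hord
    have hW0 := eq_zero_of_degree_le_of_ordZero_translate t _ hWdeg hord'
    have hcoeff := coeff_rungPoly p f R B c β
    rw [hW0, coeff_zero, if_pos hβ] at hcoeff
    have hch : (((β.degree + R).choose (p ^ f) : ℕ) : K) = 0 := by
      rcases mul_eq_zero.mp hcoeff.symm with h | h
      · exact h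
      · exact absurd h (hc β hβ)
    exact pow_succ_dvd_of_natCast_choose_eq_zero p (hI β hβ) hch
  · rw [heq]; exact hs1

/-- **THE LADDER** `I_0 ⇒ I_1 ⇒ … ⇒ I_e`: if the order hypothesis holds at every level `f < e`, then
`q = p^e` divides `|β| + R` for every `β ∈ B`. [folklore] -/
theorem ladder (p : ℕ) [Fact p.Prime] [CharP K p] {e : ℕ} (t : σ → K) (B : Finset (σ →₀ ℕ))
    (c : (σ →₀ ℕ) → K) (hc : ∀ β ∈ B, c β ≠ 0) (R s : ℕ) (hs : p ^ e ∣ s)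
    (hdeg : ∀ β ∈ B, β.degree + R ≤ s)
    (hord : ∀ f, f < e →
      ((s - R + 1 - p ^ f : ℕ) : ℕ∞) ≤ ordZero (PointBlowup.translate t (rungPoly p f R B c))) :
    ∀ β ∈ B, p ^ e ∣ β.degree + R := by
  suffices h : ∀ f, f ≤ e → ∀ β ∈ B, p ^ f ∣ β.degree + R from h e le_rfl
  intro f
  induction f with
  | zero => intro _ β _; rw [pow_zero]; exact one_dvd _
  | succ f ih =>
    intro hfe
    exact rung p (by omega) t B c hc R s hs hdeg (ih (by omega)) (hord f (by omega))

/-! ## §3 The unit factor `(x + t)^r` and Step (β) -/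

/-- A translated monomial `(x + t)^r` with `t_m ≠ 0` on `supp r` is a unit at the origin: multiplying by
it does not change `ord₀`. [folklore] -/
theorem ordZero_translate_monomial_mul (t : σ → K) (r : σ →₀ ℕ) (ht : ∀ m ∈ r.support, t m ≠ 0)
    (W : MvPolynomial σ K) :
    ordZero (PointBlowup.translate t (monomial r (1 : K)) * W) = ordZero W := by
  have hE : ordZero (PointBlowup.translate t (monomial r (1 : K))) = 0 := by
    rw [ordZero_eq_zero_iff, PointBlowup.translate_monomial_eq_prod, map_mul, constantCoeff_C, one_mul,
      map_prod]
    refine Finset.prod_ne_zero_iff.mpr fun i _ => ?_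
    rw [map_pow, map_add, constantCoeff_X, constantCoeff_C, zero_add]
    by_cases hi : i ∈ r.support
    · exact pow_ne_zero _ (ht i hi)
    · rw [Finsupp.notMem_support_iff.mp hi, pow_zero]; exact one_ne_zero
  rw [ordZero_mul, hE, zero_add]

omit [Fintype σ] in
/-- The diagonal image of `x^r · Σ_β c_β x^β` at level `ℓ` is `x^r · W_ℓ` (degrees shift by `|r|`).
[folklore] -/
theorem diag_monomial_mul_eq (p f : ℕ) (r : σ →₀ ℕ) (B : Finset (σ →₀ ℕ)) (c : (σ →₀ ℕ) → K)
    (hc : ∀ β ∈ B, c β ≠ 0) :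
    (∑ b ∈ (monomial r (1 : K) * ∑ β ∈ B, monomial β (c β)).support,
        ((b.degree.choose (p ^ f) : ℕ) : K) • monomial b (coeff b (monomial r (1 : K) * ∑ β ∈ B, monomial β (c β)))) =
      monomial r (1 : K) * rungPoly p f r.degree B c := by
  set Q := monomial r (1 : K) * ∑ β ∈ B, monomial β (c β) with hQ
  have hQ' : Q = ∑ β ∈ B, monomial (r + β) (c β) := by
    rw [hQ, Finset.mul_sum]
    refine Finset.sum_congr rfl fun β _ => ?_
    rw [monomial_mul, one_mul]
  have hcoeffQ : ∀ b, coeff b Q = if ∃ β ∈ B, r + β = b then c (b - r) else 0 := by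
    intro b
    rw [hQ', coeff_sum]
    simp_rw [coeff_monomial]
    split_ifs with h
    · obtain ⟨β, hβ, rfl⟩ := h
      rw [Finset.sum_eq_single β, if_pos rfl, add_tsub_cancel_left]
      · intro β' _ hne; rw [if_neg (fun h => hne (add_left_cancel h))]
      · intro h; exact absurd hβ h
    · exact Finset.sum_eq_zero fun β hβ => if_neg fun h' => h ⟨β, hβ, h'⟩
  have hsupp : Q.support = B.map (addLeftEmbedding r) := by
    ext b
    rw [MvPolynomial.mem_support_iff, hcoeffQ, Finset.mem_map]
    constructor
    · intro h
      split_ifs at h with h'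
      · obtain ⟨β, hβ, rfl⟩ := h'; exact ⟨β, hβ, rfl⟩
      · exact absurd rfl h
    · rintro ⟨β, hβ, rfl⟩
      rw [if_pos ⟨β, hβ, rfl⟩]
      show c (r + β - r) ≠ 0
      rw [add_tsub_cancel_left]; exact hc β hβ
  rw [hsupp, Finset.sum_map, rungPoly, Finset.mul_sum]
  refine Finset.sum_congr rfl fun β hβ => ?_
  rw [addLeftEmbedding_apply, hcoeffQ, if_pos ⟨β, hβ, rfl⟩, add_tsub_cancel_left, map_add,
    Algebra.mul_smul_comm, monomial_mul, one_mul, add_comm r.degree]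

/-- **STEP (β), algebraic core.**  Let `P := (x^r · Σ_{β ∈ B} c_β x^β)(x + t)` (`c_β ≠ 0`, `t ≠ 0` on
`supp r`, `|β| + |r| ≤ s` on `B`, `q = p^e ∣ s`).  If every monomial of `P` of total degree `≤ s − |r|`
is a `q`-th power (HYPOTHESIS H of CARD I-5-5's Step (β), with `κ_max = s − R`), then `q ∣ |β| + |r|`
for EVERY `β ∈ B`.  In the plateau-law proof `B ∋ a_T − r` with `|a_T| ≢ 0 (mod q)` — contradiction.
[folklore] -/
theorem step_beta_core (p : ℕ) [Fact p.Prime] [CharP K p] {e : ℕ} (t : σ → K) (r : σ →₀ ℕ)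
    (ht : ∀ m ∈ r.support, t m ≠ 0) (B : Finset (σ →₀ ℕ)) (c : (σ →₀ ℕ) → K)
    (hc : ∀ β ∈ B, c β ≠ 0) (s : ℕ) (hs : p ^ e ∣ s) (hdeg : ∀ β ∈ B, β.degree + r.degree ≤ s)
    (H : ∀ d ∈ (PointBlowup.translate t (monomial r (1 : K) * ∑ β ∈ B, monomial β (c β))).support,
      d.degree ≤ s - r.degree → ∀ i, p ^ e ∣ d i) :
    ∀ β ∈ B, p ^ e ∣ β.degree + r.degree := by
  refine ladder p t B c hc r.degree s hs hdeg fun f hf => ?_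
  have hℓ0 : 0 < p ^ f := pow_pos (Fact.out : p.Prime).pos f
  have hℓ : p ^ f < p ^ e := Nat.pow_lt_pow_right (Fact.out : p.Prime).one_lt hf
  have key := le_ordZero_translate_diagonal p (κ := s - r.degree) hℓ0 hℓ t
    (monomial r (1 : K) * ∑ β ∈ B, monomial β (c β)) H
  rwa [diag_monomial_mul_eq p f r B c hc, MohAlong.translate_mul, ordZero_translate_monomial_mul t r ht]
    at key

end HasseEuler

end Summit.ResolutionOfSingularities.ResolutionOfSingularities.Theorems.PIDim4
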